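import Summits.AtomisticToContinuum.HydrodynamicLimit.Theorems.AntiMazurCoboundariesCellForecastPressureDecayClusterTailAssemblyA
import HarnessLib

/-!
# S2e-5 · assembly of the cluster tail (registered sub-goal `stub_clusterTail_assembly` of stub `stub_clusterTail`,
# crux line `enskog-compensator-martingale`, crux `CellForecastPressureDecay`, stmt-AtomisticToContinuum-13915)

The short-time cluster tail `ClusterTail σ` of the cell law (objects part B) is ASSEMBLED from the three second-order
expectation bounds of the slab `(0, Δ]` — non-fresh first contacts (`stub_clusterTail_nonFresh`), disturbed fresh pairs
(`stub_clusterTail_freshPairHit`), double cylinders (`stub_clusterTail_doubleCylinder`) — by pathwise combinatorics on the good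
set of the whole-cell flow and finite bookkeeping:
* `nonFresh_or_freshPairHit_of_bad` — (a) pathwise: a sphere that is neither free nor in an isolated pair has a first
  collision which is non-fresh, or fresh and then disturbed by a third sphere;
* `cover_of_inCylinder_not_isolatedPair` — (b) pathwise: a cylinder pair that is not isolated is a disturbed fresh pair, or
  the scheduled collision at the hitting time is pre-empted by a first contact of a member with an outsider (non-fresh: that
  member is counted by (T2) and the other member is its unique cylinder partner unless there is a double cylinder; fresh:
  a second cylinder at that member);
* `cast_card_filter_le_of_cover_two/five`, `lintegral_le_of_cover_two/three` — counting and integration (lower Lebesgue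
  integrals add on a.e.-measurable summands: the (T2) and (S3) counts, part A `stub_clusterTail_assembly_measurable`);
* `stub_clusterTail_assembly` — the registered sub-goal, with `δ₀ = L₀ = 1`, `C = 2 C_{T2} + C_{T1} + 2 C_{S3}`.

References: Gallagher–Saint-Raymond–Texier 2013, §4.1; Cercignani–Illner–Pulvirenti 1994, §2.2, §4.2.
-/

noncomputable section

open MeasureTheory ProbabilityTheory Set Filter Topology
open scoped ENNReal BigOperators InnerProductSpace
open Literature.Analysis.FluidPDE Literature.MathematicalPhysics.KineticTheory

namespace Summit.AtomisticToContinuum.HydrodynamicLimit.Theorems.EnskogCompensator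

/-! ## Pathwise covers on the good set -/

section Covers

variable {σ : ℝ} {n : ℕ} (Ψ : Flows σ) {z : Cell n} {Δ : ℝ}

/-- From "the pair `{i, j}` is not isolated" (`i ≠ j`): a third sphere `k ∉ {i, j}` collides with `i` or with `j`
at a time of the slab. [folklore] -/
theorem exists_third_of_not_isolatedPair {i j : Fin n} (hij : i ≠ j) (hniso : ¬ IsIsolatedPair Ψ Δ z i j) :
    ∃ k : Fin n, k ≠ i ∧ k ≠ j ∧ ∃ s' ∈ Set.Ioc 0 Δ,
      (Collide (Euclidean.geometry (Fin 3)) σ ((Ψ n).flow s' z) i k ∨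
        Collide (Euclidean.geometry (Fin 3)) σ ((Ψ n).flow s' z) j k) := by
  by_cases hA : ∀ s ∈ Set.Ioc 0 Δ, ∀ k, Collide (Euclidean.geometry (Fin 3)) σ ((Ψ n).flow s z) i k → k = j
  · have hB : ¬ ∀ s ∈ Set.Ioc 0 Δ, ∀ k, Collide (Euclidean.geometry (Fin 3)) σ ((Ψ n).flow s z) j k → k = i :=
      fun hB => hniso ⟨hij, hA, hB⟩
    push Not at hB
    obtain ⟨s'', hs'', k, hcjk, hki⟩ := hB
    exact ⟨k, hki, hcjk.ne.symm, s'', hs'', Or.inr hcjk⟩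
  · push Not at hA
    obtain ⟨s'', hs'', k, hcik, hkj⟩ := hA
    exact ⟨k, hcik.ne.symm, hkj, s'', hs'', Or.inl hcik⟩

/-- **(a), pathwise.** A sphere that is neither free nor in an isolated pair of the slab has a first collision, at a
time `τ ∈ (0, Δ]`, with a partner `j`: EITHER `j` already collided before `τ` (a non-fresh first contact), OR `(i, j)`
is a fresh pair which — not being isolated — is disturbed by a third sphere within the slab. [cite: GST2013, §4.1] -/
theorem nonFresh_or_freshPairHit_of_bad (hz : z ∈ (Ψ n).good) {i : Fin n}
    (hbad : ¬ (IsFreeIn Ψ Δ z i ∨ ∃ j, IsIsolatedPair Ψ Δ z i j)) :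
    (∃ j : Fin n, j ≠ i ∧ ∃ s ∈ Set.Ioc 0 Δ, Collide (Euclidean.geometry (Fin 3)) σ ((Ψ n).flow s z) i j ∧
        (∀ s' ∈ Set.Ioo 0 s, ¬ Participates (Euclidean.geometry (Fin 3)) σ ((Ψ n).flow s' z) i) ∧
        (∃ s' ∈ Set.Ioo 0 s, Participates (Euclidean.geometry (Fin 3)) σ ((Ψ n).flow s' z) j)) ∨
      ∃ j : Fin n, i ≠ j ∧ ∃ s ∈ Set.Ioc 0 Δ, Collide (Euclidean.geometry (Fin 3)) σ ((Ψ n).flow s z) i j ∧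
        (∀ s' ∈ Set.Ioo 0 s, ¬ Participates (Euclidean.geometry (Fin 3)) σ ((Ψ n).flow s' z) i ∧
          ¬ Participates (Euclidean.geometry (Fin 3)) σ ((Ψ n).flow s' z) j) ∧
        ∃ k : Fin n, k ≠ i ∧ k ≠ j ∧ ∃ s' ∈ Set.Ioc 0 Δ,
          (Collide (Euclidean.geometry (Fin 3)) σ ((Ψ n).flow s' z) i k ∨
            Collide (Euclidean.geometry (Fin 3)) σ ((Ψ n).flow s' z) j k) := by
  have hnf : ¬ IsFreeIn Ψ Δ z i := fun h => hbad (Or.inl h)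
  have hniso : ∀ j, ¬ IsIsolatedPair Ψ Δ z i j := fun j h => hbad (Or.inr ⟨j, h⟩)
  obtain ⟨s, hs, hps⟩ : ∃ s ∈ Set.Ioc 0 Δ, Participates (Euclidean.geometry (Fin 3)) σ ((Ψ n).flow s z) i := by
    by_contra h
    push Not at h
    exact hnf h
  obtain ⟨hτ0, hτs, ⟨j, hc⟩, hfree⟩ := nthCollisionTimeOf_zero_spec Ψ hz hs.1 hps
  have hτ : (Ψ n).nthCollisionTimeOf i 0 z ∈ Ioc 0 Δ := ⟨hτ0, hτs.trans hs.2⟩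
  have hji : j ≠ i := hc.ne.symm
  by_cases hj : ∃ s' ∈ Set.Ioo 0 ((Ψ n).nthCollisionTimeOf i 0 z),
    Participates (Euclidean.geometry (Fin 3)) σ ((Ψ n).flow s' z) j
  · exact Or.inl ⟨j, hji, _, hτ, hc, hfree, hj⟩
  · push Not at hj
    exact Or.inr ⟨j, hji.symm, _, hτ, hc, fun s' hs' => ⟨hfree s' hs', hj s' hs'⟩,
      exists_third_of_not_isolatedPair Ψ hji.symm (hniso j)⟩

/-- A fresh collision of `a ≠ b` at a time `τ` of the slab puts the initial data of `(a, b)` in the collision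
cylinder, with hitting time `τ` (`stub_kinematicAssembly_freshPair`). [cite: CIP1994, §2.2] -/
theorem inCylinder_of_fresh (hz : z ∈ (Ψ n).good) {a b : Fin n} {τ : ℝ} (hab : a ≠ b) (hτ : τ ∈ Set.Ioc 0 Δ)
    (hc : Collide (Euclidean.geometry (Fin 3)) σ ((Ψ n).flow τ z) a b)
    (ha : ∀ s ∈ Set.Ioo 0 τ, ¬ Participates (Euclidean.geometry (Fin 3)) σ ((Ψ n).flow s z) a)
    (hb : ∀ s ∈ Set.Ioo 0 τ, ¬ Participates (Euclidean.geometry (Fin 3)) σ ((Ψ n).flow s z) b) :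
    InCylinder σ Δ z a b ∧ pairHitTime σ ((z a).1 - (z b).1) ((z a).2 - (z b).2) = τ := by
  obtain ⟨-, -, -, -, -, htime, ⟨ω, hω, hq⟩, -⟩ :=
    stub_kinematicAssembly_freshPair σ n Ψ z hz a b τ hab hτ.1 (mem_contactSet_of_collide hc) ha hb
  exact ⟨⟨ω, τ, hτ, hω, hq⟩, htime⟩

/-- **(b), pathwise.** An ordered cylinder pair `(p, q)` of the slab that is NOT an isolated pair is covered by one
of five events: `(p, q)` is a disturbed fresh pair; the first contact of `p` (resp. `q`) is non-fresh and `q`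
(resp. `p`) is its only cylinder partner; `p` (resp. `q`) has a second cylinder partner. Indeed, if both are free
up to the hitting time `t*` they collide at `t*` (fresh) and, not being isolated, are disturbed; otherwise the first
participation `τ < t*` of `p` or `q` is with an outsider `k` (a `p–q` contact at `τ` would force `t* = τ`), which
either collided before (`p` non-fresh) or is fresh — and then `(p, k)` is a second cylinder at `p`. [cite: GST2013, §4.1] -/
theorem cover_of_inCylinder_not_isolatedPair (hσ : 0 < σ) (hz : z ∈ (Ψ n).good) {p q : Fin n} (hpq : p ≠ q)
    (hcyl : InCylinder σ Δ z p q) (hniso : ¬ IsIsolatedPair Ψ Δ z p q) :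
    (p ≠ q ∧ ∃ s ∈ Set.Ioc 0 Δ, Collide (Euclidean.geometry (Fin 3)) σ ((Ψ n).flow s z) p q ∧
        (∀ s' ∈ Set.Ioo 0 s, ¬ Participates (Euclidean.geometry (Fin 3)) σ ((Ψ n).flow s' z) p ∧
          ¬ Participates (Euclidean.geometry (Fin 3)) σ ((Ψ n).flow s' z) q) ∧
        ∃ k : Fin n, k ≠ p ∧ k ≠ q ∧ ∃ s' ∈ Set.Ioc 0 Δ,
          (Collide (Euclidean.geometry (Fin 3)) σ ((Ψ n).flow s' z) p k ∨
            Collide (Euclidean.geometry (Fin 3)) σ ((Ψ n).flow s' z) q k)) ∨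
      ((∃ j : Fin n, j ≠ p ∧ ∃ s ∈ Set.Ioc 0 Δ, Collide (Euclidean.geometry (Fin 3)) σ ((Ψ n).flow s z) p j ∧
          (∀ s' ∈ Set.Ioo 0 s, ¬ Participates (Euclidean.geometry (Fin 3)) σ ((Ψ n).flow s' z) p) ∧
          (∃ s' ∈ Set.Ioo 0 s, Participates (Euclidean.geometry (Fin 3)) σ ((Ψ n).flow s' z) j)) ∧
        InCylinder σ Δ z p q ∧ ∀ q', InCylinder σ Δ z p q' → q' = q) ∨
      (∃ k : Fin n, p ≠ q ∧ p ≠ k ∧ q ≠ k ∧ InCylinder σ Δ z p q ∧ InCylinder σ Δ z p k) ∨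
      ((∃ j : Fin n, j ≠ q ∧ ∃ s ∈ Set.Ioc 0 Δ, Collide (Euclidean.geometry (Fin 3)) σ ((Ψ n).flow s z) q j ∧
          (∀ s' ∈ Set.Ioo 0 s, ¬ Participates (Euclidean.geometry (Fin 3)) σ ((Ψ n).flow s' z) q) ∧
          (∃ s' ∈ Set.Ioo 0 s, Participates (Euclidean.geometry (Fin 3)) σ ((Ψ n).flow s' z) j)) ∧
        InCylinder σ Δ z q p ∧ ∀ q', InCylinder σ Δ z q q' → q' = p) ∨
      (∃ k : Fin n, q ≠ p ∧ q ≠ k ∧ p ≠ k ∧ InCylinder σ Δ z q p ∧ InCylinder σ Δ z q k) := by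
  have htraj := (Ψ n).isTrajectory z hz
  obtain ⟨hhits, -, hT⟩ := (inCylinder_iff_pairHits hσ Δ z p q).1 hcyl
  -- uniqueness of the cylinder partner, or a double cylinder
  by_cases hUp : ∀ q', InCylinder σ Δ z p q' → q' = q
  swap
  · push Not at hUp
    obtain ⟨k, hk, hkq⟩ := hUp
    exact Or.inr (Or.inr (Or.inl ⟨k, hpq, hk.ne, fun h => hkq h.symm, hcyl, hk⟩))
  by_cases hUq : ∀ q', InCylinder σ Δ z q q' → q' = p
  swap
  · push Not at hUq
    obtain ⟨k, hk, hkp⟩ := hUq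
    exact Or.inr (Or.inr (Or.inr (Or.inr ⟨k, hpq.symm, hk.ne, fun h => hkp h.symm, (inCylinder_comm.1 hcyl), hk⟩)))
  by_cases hF : ∀ s ∈ Ioo 0 (pairHitTime σ ((z p).1 - (z q).1) ((z p).2 - (z q).2)),
    ¬ Participates (Euclidean.geometry (Fin 3)) σ ((Ψ n).flow s z) p ∧
      ¬ Participates (Euclidean.geometry (Fin 3)) σ ((Ψ n).flow s z) q
  · -- sub-case F: the free pair collides at its hitting time; not isolated, hence disturbed
    have hc := collide_of_free_pairHits hσ Ψ hz hpq hhits hT.1 (fun s hs => (hF s hs).1) (fun s hs => (hF s hs).2)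
    exact Or.inl ⟨hpq, _, hT, hc, hF, exists_third_of_not_isolatedPair Ψ hpq hniso⟩
  -- sub-case N: the first participation `τ < t*` of `p` or `q`
  push Not at hF
  obtain ⟨s₀, hs₀, hpq₀⟩ := hF
  obtain ⟨S, hS⟩ : ∃ S : Set ℝ, S = {s | Participates (Euclidean.geometry (Fin 3)) σ ((Ψ n).flow s z) p ∨
      Participates (Euclidean.geometry (Fin 3)) σ ((Ψ n).flow s z) q} := ⟨_, rfl⟩
  have hmemS : ∀ {s}, s ∈ S ↔ Participates (Euclidean.geometry (Fin 3)) σ ((Ψ n).flow s z) p ∨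
      Participates (Euclidean.geometry (Fin 3)) σ ((Ψ n).flow s z) q := by
    intro s; rw [hS]; rfl
  have hSsub : S ⊆ collisionTimes (Euclidean.geometry (Fin 3)) σ (fun t => (Ψ n).flow t z) := fun s hs =>
    (hmemS.1 hs).elim (fun h => collisionTimesOf_subset _ p h) (fun h => collisionTimesOf_subset _ q h)
  have hfin : ∀ b, (S ∩ Ioc 0 b).Finite := fun b =>
    (htraj.finite_collisionTimes_inter_of_subset_Icc Ioc_subset_Icc_self).subset (inter_subset_inter_left _ hSsub)
  have hs₀S : s₀ ∈ S := by
    by_cases h : Participates (Euclidean.geometry (Fin 3)) σ ((Ψ n).flow s₀ z) p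
    · exact hmemS.2 (Or.inl h)
    · exact hmemS.2 (Or.inr (hpq₀ h))
  have hl := isLeast_nextTimeAfter hfin ⟨s₀, hs₀S, hs₀.1⟩
  have hτ0 : 0 < nextTimeAfter S 0 := hl.1.2
  have hτT : nextTimeAfter S 0 < pairHitTime σ ((z p).1 - (z q).1) ((z p).2 - (z q).2) :=
    (hl.2 ⟨hs₀S, hs₀.1⟩).trans_lt hs₀.2
  have hτ : nextTimeAfter S 0 ∈ Ioc 0 Δ := ⟨hτ0, hτT.le.trans hT.2⟩
  have hfree : ∀ s ∈ Ioo 0 (nextTimeAfter S 0), ¬ Participates (Euclidean.geometry (Fin 3)) σ ((Ψ n).flow s z) p ∧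
      ¬ Participates (Euclidean.geometry (Fin 3)) σ ((Ψ n).flow s z) q := fun s hs =>
    ⟨fun h => (not_lt.2 (hl.2 ⟨hmemS.2 (Or.inl h), hs.1⟩)) hs.2,
      fun h => (not_lt.2 (hl.2 ⟨hmemS.2 (Or.inr h), hs.1⟩)) hs.2⟩
  -- no `p–q` contact at `τ`: it would be a fresh collision with hitting time `τ < t*`
  have hnot : ¬ Collide (Euclidean.geometry (Fin 3)) σ ((Ψ n).flow (nextTimeAfter S 0) z) p q := fun hc =>
    hτT.ne (inCylinder_of_fresh Ψ hz hpq hτ hc (fun s hs => (hfree s hs).1) (fun s hs => (hfree s hs).2)).2.symm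
  rcases hmemS.1 hl.1.1 with ⟨k, hck⟩ | ⟨k, hck⟩
  · -- `p` collides first, with an outsider `k ≠ q`
    have hkq : k ≠ q := fun h => hnot (h ▸ hck)
    by_cases hkfree : ∀ s ∈ Ioo 0 (nextTimeAfter S 0), ¬ Participates (Euclidean.geometry (Fin 3)) σ ((Ψ n).flow s z) k
    · exact absurd (hUp k (inCylinder_of_fresh Ψ hz hck.ne hτ hck (fun s hs => (hfree s hs).1) hkfree).1) hkq
    · push Not at hkfree
      exact Or.inr (Or.inl ⟨⟨k, hck.ne.symm, _, hτ, hck, fun s hs => (hfree s hs).1, hkfree⟩, hcyl, hUp⟩)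
  · -- `q` collides first, with an outsider `k ≠ p`
    have hkp : k ≠ p := fun h => hnot (h ▸ hck).symm
    by_cases hkfree : ∀ s ∈ Ioo 0 (nextTimeAfter S 0), ¬ Participates (Euclidean.geometry (Fin 3)) σ ((Ψ n).flow s z) k
    · exact absurd (hUq k (inCylinder_of_fresh Ψ hz hck.ne hτ hck (fun s hs => (hfree s hs).2) hkfree).1) hkp
    · push Not at hkfree
      exact Or.inr (Or.inr (Or.inr (Or.inl
        ⟨⟨k, hck.ne.symm, _, hτ, hck, fun s hs => (hfree s hs).2, hkfree⟩, (inCylinder_comm.1 hcyl), hUq⟩)))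

end Covers

/-! ## Finite bookkeeping and integration -/

section Counting

variable {α : Type*} [Fintype α]

/-- (a), counting: a set of labels covered by `Q ∪ fst(R)` has at most `#Q + #R` elements. [folklore] -/
theorem cast_card_filter_le_of_cover_two {P Q : α → Prop} {R : α × α → Prop} {_ : DecidablePred P}
    {_ : DecidablePred Q} {_ : DecidablePred R} (h : ∀ i, P i → Q i ∨ ∃ j, R (i, j)) :
    ((Finset.univ.filter P).card : ℝ≥0∞) ≤
      ((Finset.univ.filter Q).card : ℝ≥0∞) + ((Finset.univ.filter R).card : ℝ≥0∞) := by
  classical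
  have hnat : (Finset.univ.filter P).card ≤ (Finset.univ.filter Q).card + (Finset.univ.filter R).card := by
    calc (Finset.univ.filter P).card
        ≤ (Finset.univ.filter Q ∪ (Finset.univ.filter R).image Prod.fst).card := by
          refine Finset.card_le_card fun i hi => ?_
          rcases h i (Finset.mem_filter.1 hi).2 with hq | ⟨j, hj⟩
          · exact Finset.mem_union_left _ (Finset.mem_filter.2 ⟨Finset.mem_univ _, hq⟩)
          · exact Finset.mem_union_right _
              (Finset.mem_image.2 ⟨(i, j), Finset.mem_filter.2 ⟨Finset.mem_univ _, hj⟩, rfl⟩)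
      _ ≤ (Finset.univ.filter Q).card + ((Finset.univ.filter R).image Prod.fst).card := Finset.card_union_le _ _
      _ ≤ (Finset.univ.filter Q).card + (Finset.univ.filter R).card :=
          Nat.add_le_add_left Finset.card_image_le _
  exact_mod_cast hnat

/-- (b), counting: a set of ordered pairs covered by the five events of `cover_of_inCylinder_not_isolatedPair` — `P₁`; first
component in `P₂` with the second as its UNIQUE `cyl`-partner (an injection into `P₂`); a triple of `P₃` above it; and
the two mirrored events — has at most `#P₁ + 2 #P₂ + 2 #P₃` elements. [folklore] -/
theorem cast_card_filter_le_of_cover_five [DecidableEq α] {PB P₁ : α × α → Prop} {P₂ : α → Prop}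
    {P₃ : α × α × α → Prop} (cyl : α → α → Prop) {_ : DecidablePred PB} {_ : DecidablePred P₁} {_ : DecidablePred P₂}
    {_ : DecidablePred P₃}
    (h : ∀ pq, PB pq → P₁ pq ∨ (P₂ pq.1 ∧ cyl pq.1 pq.2 ∧ ∀ q', cyl pq.1 q' → q' = pq.2) ∨ (∃ k, P₃ (pq.1, pq.2, k)) ∨
      (P₂ pq.2 ∧ cyl pq.2 pq.1 ∧ ∀ q', cyl pq.2 q' → q' = pq.1) ∨ (∃ k, P₃ (pq.2, pq.1, k))) :
    ((Finset.univ.filter PB).card : ℝ≥0∞) ≤ ((Finset.univ.filter P₁).card : ℝ≥0∞) +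
      2 * ((Finset.univ.filter P₂).card : ℝ≥0∞) + 2 * ((Finset.univ.filter P₃).card : ℝ≥0∞) := by
  classical
  set B := Finset.univ.filter PB
  set T₁ := Finset.univ.filter P₁
  set T₂ := Finset.univ.filter P₂
  set S₃ := Finset.univ.filter P₃
  set A₁ := B.filter fun pq => P₂ pq.1 ∧ cyl pq.1 pq.2 ∧ ∀ q', cyl pq.1 q' → q' = pq.2 with hA₁
  set A₁' := B.filter fun pq => P₂ pq.2 ∧ cyl pq.2 pq.1 ∧ ∀ q', cyl pq.2 q' → q' = pq.1 with hA₁'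
  set A₂ := S₃.image fun t => (t.1, t.2.1) with hA₂
  set A₂' := S₃.image fun t => (t.2.1, t.1) with hA₂'
  have h₁ : A₁.card ≤ T₂.card := by
    refine Finset.card_le_card_of_injOn Prod.fst (fun pq hpq => ?_) ?_
    · exact Finset.mem_filter.2 ⟨Finset.mem_univ _, (Finset.mem_filter.1 hpq).2.1⟩
    · intro x hx y hy hxy
      have hx' := (Finset.mem_filter.1 hx).2
      have hy' := (Finset.mem_filter.1 hy).2
      refine Prod.ext hxy (hy'.2.2 x.2 ?_)
      have h := hx'.2.1
      rwa [show x.1 = y.1 from hxy] at h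
  have h₁' : A₁'.card ≤ T₂.card := by
    refine Finset.card_le_card_of_injOn Prod.snd (fun pq hpq => ?_) ?_
    · exact Finset.mem_filter.2 ⟨Finset.mem_univ _, (Finset.mem_filter.1 hpq).2.1⟩
    · intro x hx y hy hxy
      have hx' := (Finset.mem_filter.1 hx).2
      have hy' := (Finset.mem_filter.1 hy).2
      refine Prod.ext (hy'.2.2 x.1 ?_) hxy
      have h := hx'.2.1
      rwa [show x.2 = y.2 from hxy] at h
  have h₂ : A₂.card ≤ S₃.card := Finset.card_image_le
  have h₂' : A₂'.card ≤ S₃.card := Finset.card_image_le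
  have hcov : B ⊆ T₁ ∪ A₁ ∪ A₂ ∪ A₁' ∪ A₂' := by
    intro pq hpq
    simp only [Finset.mem_union]
    rcases h pq (Finset.mem_filter.1 hpq).2 with hp | hp | ⟨k, hk⟩ | hp | ⟨k, hk⟩
    · exact Or.inl (Or.inl (Or.inl (Or.inl (Finset.mem_filter.2 ⟨Finset.mem_univ _, hp⟩))))
    · exact Or.inl (Or.inl (Or.inl (Or.inr (Finset.mem_filter.2 ⟨hpq, hp⟩))))
    · exact Or.inl (Or.inl (Or.inr (Finset.mem_image.2 ⟨(pq.1, pq.2, k), Finset.mem_filter.2 ⟨Finset.mem_univ _, hk⟩, rfl⟩)))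
    · exact Or.inl (Or.inr (Finset.mem_filter.2 ⟨hpq, hp⟩))
    · exact Or.inr (Finset.mem_image.2 ⟨(pq.2, pq.1, k), Finset.mem_filter.2 ⟨Finset.mem_univ _, hk⟩, rfl⟩)
  have hnat : B.card ≤ T₁.card + 2 * T₂.card + 2 * S₃.card :=
    calc B.card ≤ (T₁ ∪ A₁ ∪ A₂ ∪ A₁' ∪ A₂').card := Finset.card_le_card hcov
      _ ≤ T₁.card + A₁.card + A₂.card + A₁'.card + A₂'.card := by
          refine (Finset.card_union_le _ _).trans (Nat.add_le_add_right ?_ _)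
          refine (Finset.card_union_le _ _).trans (Nat.add_le_add_right ?_ _)
          refine (Finset.card_union_le _ _).trans (Nat.add_le_add_right ?_ _)
          exact Finset.card_union_le _ _
      _ ≤ T₁.card + T₂.card + S₃.card + T₂.card + S₃.card := by gcongr
      _ = T₁.card + 2 * T₂.card + 2 * S₃.card := by ring
  exact_mod_cast hnat

end Counting

section Integration

variable {α : Type*} [MeasurableSpace α] {μ : Measure α} {s : Set α}

/-- (a), integration: on a set of full measure `g ≤ f₂ + f₁` with `f₂` a.e.-measurable ⟹ `∫⁻ g ≤ ∫⁻ f₂ + ∫⁻ f₁` (lower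
Lebesgue integrals are additive as soon as ONE summand is a.e.-measurable). [folklore] -/
theorem lintegral_le_of_cover_two (hs : ∀ᵐ x ∂μ, x ∈ s) {g f₁ f₂ : α → ℝ≥0∞} (hf₂ : AEMeasurable f₂ μ) {a₁ a₂ : ℝ≥0∞}
    (h₁ : ∫⁻ x, f₁ x ∂μ ≤ a₁) (h₂ : ∫⁻ x, f₂ x ∂μ ≤ a₂) (hpt : ∀ x ∈ s, g x ≤ f₂ x + f₁ x) :
    ∫⁻ x, g x ∂μ ≤ a₂ + a₁ :=
  calc ∫⁻ x, g x ∂μ ≤ ∫⁻ x, f₂ x + f₁ x ∂μ := lintegral_mono_ae (by filter_upwards [hs] with x hx using hpt x hx)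
    _ = ∫⁻ x, f₂ x ∂μ + ∫⁻ x, f₁ x ∂μ := lintegral_add_left' hf₂ _
    _ ≤ a₂ + a₁ := add_le_add h₂ h₁

/-- (b), integration: on a set of full measure `g ≤ f₁ + 2 f₂ + 2 f₃` with `f₂, f₃` a.e.-measurable ⟹
`∫⁻ g ≤ ∫⁻ f₁ + 2 ∫⁻ f₂ + 2 ∫⁻ f₃`. [folklore] -/
theorem lintegral_le_of_cover_three (hs : ∀ᵐ x ∂μ, x ∈ s) {g f₁ f₂ f₃ : α → ℝ≥0∞} (hf₂ : AEMeasurable f₂ μ)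
    (hf₃ : AEMeasurable f₃ μ) {a₁ a₂ a₃ : ℝ≥0∞} (h₁ : ∫⁻ x, f₁ x ∂μ ≤ a₁) (h₂ : ∫⁻ x, f₂ x ∂μ ≤ a₂)
    (h₃ : ∫⁻ x, f₃ x ∂μ ≤ a₃) (hpt : ∀ x ∈ s, g x ≤ f₁ x + 2 * f₂ x + 2 * f₃ x) :
    ∫⁻ x, g x ∂μ ≤ a₁ + 2 * a₂ + 2 * a₃ :=
  calc ∫⁻ x, g x ∂μ ≤ ∫⁻ x, (2 * f₂ x + 2 * f₃ x) + f₁ x ∂μ :=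
        lintegral_mono_ae (by
          filter_upwards [hs] with x hx
          calc g x ≤ f₁ x + 2 * f₂ x + 2 * f₃ x := hpt x hx
            _ = (2 * f₂ x + 2 * f₃ x) + f₁ x := by ring)
    _ = ∫⁻ x, (2 * f₂ x + 2 * f₃ x) ∂μ + ∫⁻ x, f₁ x ∂μ := lintegral_add_left' ((hf₂.const_mul 2).add (hf₃.const_mul 2)) _
    _ = 2 * ∫⁻ x, f₂ x ∂μ + 2 * ∫⁻ x, f₃ x ∂μ + ∫⁻ x, f₁ x ∂μ := by
        rw [lintegral_add_left' (hf₂.const_mul 2), lintegral_const_mul'' 2 hf₂, lintegral_const_mul'' 2 hf₃]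
    _ ≤ 2 * a₂ + 2 * a₃ + a₁ := by gcongr
    _ = a₁ + 2 * a₂ + 2 * a₃ := by ring

end Integration

/-! ## The registered sub-goal: assembly of the cluster tail -/

open Classical in
/-- **Registered sub-goal `stub_clusterTail_assembly`** (S2e-5 of stub `stub_clusterTail`, line `enskog-compensator-martingale`):
**assembly of the cluster tail** from the three second-order bounds (pathwise combinatorics on the good set + bookkeeping).
A sphere that is neither free nor in an isolated pair has a first collision which is either non-fresh (`H_T2`) or fresh and
then disturbed (`H_T1`): `#(a) ≤ #T2 + #T1`. A cylinder pair that is not isolated is either a disturbed fresh pair (`H_T1`),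
or its scheduled collision at the hitting time is pre-empted by a first contact of one of its members with an outsider —
non-fresh (the member is in `T2`, and either the other member is its unique cylinder partner or there is a double cylinder)
or fresh (a second cylinder at that member, `H_S3`): `#(b) ≤ #T1 + 2 #T2 + 2 #S3`. Integrate (the `T2` and `S3` counts
are a.e.-measurable, `stub_clusterTail_assembly_measurable`, so the lower integrals add) with `δ₀ = L₀ = 1`,
`C = 2 C_{T2} + C_{T1} + 2 C_{S3}`. [cite: GST2013, §4.1] -/
theorem stub_clusterTail_assembly : ∀ σ : ℝ, 0 < σ → σ ≤ 3 / 16 →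
    (∃ C : ℝ, 0 ≤ C ∧ ∀ L : ℝ, 1 ≤ L → ∀ n : ℕ, (n : ℝ) ≤ 2 * L ^ 3 → ∀ (Ψ : Flows σ) (Δ : ℝ), 0 < Δ → Δ ≤ 1 →
      ∫⁻ z, ((Finset.univ.filter fun i : Fin n => ∃ j : Fin n, j ≠ i ∧ ∃ s ∈ Set.Ioc 0 Δ,
          Collide (Euclidean.geometry (Fin 3)) σ ((Ψ n).flow s z) i j ∧
          (∀ s' ∈ Set.Ioo 0 s, ¬ Participates (Euclidean.geometry (Fin 3)) σ ((Ψ n).flow s' z) i) ∧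
          (∃ s' ∈ Set.Ioo 0 s, Participates (Euclidean.geometry (Fin 3)) σ ((Ψ n).flow s' z) j)).card : ℝ≥0∞)
          ∂(cellLaw σ L n Ψ) ≤ ENNReal.ofReal (C * (L ^ 3 * Δ ^ 2 + L ^ 2 * Δ))) →
    (∃ C : ℝ, 0 ≤ C ∧ ∀ L : ℝ, 1 ≤ L → ∀ n : ℕ, (n : ℝ) ≤ 2 * L ^ 3 → ∀ (Ψ : Flows σ) (Δ : ℝ), 0 < Δ → Δ ≤ 1 →
      ∫⁻ z, ((Finset.univ.filter fun p : Fin n × Fin n => p.1 ≠ p.2 ∧ ∃ s ∈ Set.Ioc 0 Δ,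
          Collide (Euclidean.geometry (Fin 3)) σ ((Ψ n).flow s z) p.1 p.2 ∧
          (∀ s' ∈ Set.Ioo 0 s, ¬ Participates (Euclidean.geometry (Fin 3)) σ ((Ψ n).flow s' z) p.1 ∧
            ¬ Participates (Euclidean.geometry (Fin 3)) σ ((Ψ n).flow s' z) p.2) ∧
          ∃ k : Fin n, k ≠ p.1 ∧ k ≠ p.2 ∧ ∃ s' ∈ Set.Ioc 0 Δ,
            (Collide (Euclidean.geometry (Fin 3)) σ ((Ψ n).flow s' z) p.1 k ∨
              Collide (Euclidean.geometry (Fin 3)) σ ((Ψ n).flow s' z) p.2 k)).card : ℝ≥0∞)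
          ∂(cellLaw σ L n Ψ) ≤ ENNReal.ofReal (C * (L ^ 3 * Δ ^ 2 + L ^ 2 * Δ))) →
    (∃ C : ℝ, 0 ≤ C ∧ ∀ L : ℝ, 1 ≤ L → ∀ n : ℕ, (n : ℝ) ≤ 2 * L ^ 3 → ∀ (Ψ : Flows σ) (Δ : ℝ), 0 < Δ → Δ ≤ 1 →
      ∫⁻ z, ((Finset.univ.filter fun t : Fin n × Fin n × Fin n => t.1 ≠ t.2.1 ∧ t.1 ≠ t.2.2 ∧ t.2.1 ≠ t.2.2 ∧
          InCylinder σ Δ z t.1 t.2.1 ∧ InCylinder σ Δ z t.1 t.2.2).card : ℝ≥0∞)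
          ∂(cellLaw σ L n Ψ) ≤ ENNReal.ofReal (C * (L ^ 3 * Δ ^ 2 + L ^ 2 * Δ))) →
    ClusterTail σ := by
  intro σ hσ _hσ' hT2 hT1 hS3
  obtain ⟨C₁, hC₁, h₁⟩ := hT2
  obtain ⟨C₂, hC₂, h₂⟩ := hT1
  obtain ⟨C₃, hC₃, h₃⟩ := hS3
  refine ⟨2 * C₁ + C₂ + 2 * C₃, by positivity, 1, one_pos, 1, one_pos, ?_⟩
  intro L hL n hn Ψ Δ hΔ hΔ1
  have hgood := ae_mem_good_cellLaw σ L n Ψ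
  have hm₂ := aemeasurable_card_nonFresh σ L n Ψ Δ
  have hm₃ := (measurable_card_doubleCylinder hσ n Δ).aemeasurable (μ := cellLaw σ L n Ψ)
  have hL0 : 0 ≤ L := by linarith
  have hX : 0 ≤ L ^ 3 * Δ ^ 2 + L ^ 2 * Δ := by positivity
  refine ⟨(lintegral_le_of_cover_two hgood hm₂ (h₂ L hL n hn Ψ Δ hΔ hΔ1) (h₁ L hL n hn Ψ Δ hΔ hΔ1)
      fun z hz => ?_).trans ?_,
    (lintegral_le_of_cover_three hgood hm₂ hm₃ (h₂ L hL n hn Ψ Δ hΔ hΔ1) (h₁ L hL n hn Ψ Δ hΔ hΔ1)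
      (h₃ L hL n hn Ψ Δ hΔ hΔ1) fun z hz => ?_).trans ?_⟩
  · exact cast_card_filter_le_of_cover_two fun i hi => nonFresh_or_freshPairHit_of_bad Ψ hz hi
  · rw [← ENNReal.ofReal_add (by positivity) (by positivity)]
    exact ENNReal.ofReal_le_ofReal (by nlinarith)
  · exact cast_card_filter_le_of_cover_five (InCylinder σ Δ z) fun pq hpq =>
      cover_of_inCylinder_not_isolatedPair Ψ hσ hz hpq.1 hpq.2.1 hpq.2.2
  · rw [two_mul, two_mul, ← ENNReal.ofReal_add (by positivity) (by positivity),
      ← ENNReal.ofReal_add (by positivity) (by positivity), ← ENNReal.ofReal_add (by positivity) (by positivity),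
      ← ENNReal.ofReal_add (by positivity) (by positivity)]
    exact ENNReal.ofReal_le_ofReal (by nlinarith)

end Summit.AtomisticToContinuum.HydrodynamicLimit.Theorems.EnskogCompensator

end
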